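import Summits.KontsevichZagierPeriods.KontsevichZagierPeriods.Theses.FermatIsogeny
import Summits.KontsevichZagierPeriods.KontsevichZagierPeriods.Theorems.FermatIsogenyBetaLinearSectorHalfIntegers
import Summits.KontsevichZagierPeriods.KontsevichZagierPeriods.Theorems.FermatIsogenyBetaLinearSectorThirdsStubBetaValues
import Summits.KontsevichZagierPeriods.KontsevichZagierPeriods.Theorems.FermatIsogenyBetaLinearSectorThirdsStubPiGammaMonomial
import Summits.KontsevichZagierPeriods.KontsevichZagierPeriods.Theorems.TorsionLogsGKZLevelThreePairBetaArctan

/-!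
# `BetaLinearSector` on the THIRD-INTEGER sector, UNCONDITIONALLY (level `3`: the Chudnovsky sector)

Crux `BetaLinearSector` (stmt-KontsevichZagierPeriods-3897, route FermatIsogeny): two one-dimensional Kontsevich–Zagier representations
pinned on `(0,1)` as `[t^{a-1}(1-t)^{b-1}]` and `[c·t^{a'-1}(1-t)^{b'-1}]` (`a b a' b'` positive rationals, `c` real algebraic) with the same
value are KZ-equivalent.  Closed in general modulo the named fact `HuberWustholzCurvePeriods` (`…BetaLinearSectorGreen.lean`), proved on the
half-integer sector from Lindemann (`…BetaLinearSectorHalfIntegers.lean`); THIS file proves it UNCONDITIONALLY on the sector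
`a, b, a', b' ∈ ⅓ℕ_{>0}` — the registered anchor `betaLinearSector_thirds` — where the Beta values fall into the four classes
`ℚ̄·1`, `ℚ̄·π`, `ℚ̄·Γ(1/3)³/π`, `ℚ̄·π²/Γ(1/3)³` and the transcendence input is CHUDNOVSKY's theorem "`π` and `Γ(1/3)` are algebraically
independent" (1976), PROVED in the tree (`Literature.NumberTheory.Transcendental.algebraicIndependent_real_pi_gamma_one_third`), through the
landed stub `stub_piGammaMonomial` (distinct monomials `π^m Γ(1/3)^n` are never algebraic multiples of one another).
Part I — LEVEL REDUCTION inside the calculus with the landed chains of the half-integer file (`pinned_swap`, `P_lower_left`, `P_swap_left`):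
strong induction on `⌊a⌋ + ⌊b⌋` keeping THIRD-integrality (`P_of_base_left_third`).  Part II — LEVEL `3`, exponents in `{1/3, 2/3, 1}`:
NORMAL FORM (`normalForm`) — every base cell `[c·β(a,b)]` is a chain of moves away from `(c q)·T_i` for a positive real algebraic `q` and one of
four canonical cells `T_0 = [β(1,1)]` (rational class, ONE Newton–Leibniz move `KZ.betaFirst_equivalent_unit_constMul` + swap),
`T_1 = [(√3/2)β(1/3,2/3)]` (the `π`-class), `T_2 = [(2/√3)β(1/3,1/3)]`, `T_3 = [(1/4)β(2/3,2/3)]`, with value `c q v_i`,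
`v = (1, π, Γ(1/3)³/π, π²/Γ(1/3)³)` (closed forms: landed stub `stub_betaValuesThird`); same class ⇒ same multiple of the same canonical cell,
different classes ⇒ no common value for non-zero algebraic constants (`v_sep`); degenerate constants ⇒ two zero representations.  Hence
**Conjecture 1 of Kontsevich–Zagier for every pair of Beta integrals with parameters in `⅓ℤ`**, unconditionally — the first rung of the crux
whose transcendence input is of CM (Chudnovsky) strength.

References: M. Kontsevich, D. Zagier, *Periods* (2001), §1.2; G. V. Chudnovsky, *Contributions to the theory of transcendental numbers*
(1984), Ch. 7 §2 Cor. 2.3; G. E. Andrews, R. Askey, R. Roy, *Special Functions* (1999), §1.1.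
-/

noncomputable section

namespace Summit.KontsevichZagierPeriods.FermatIsogeny.BetaLinearSector.Thirds

open MeasureTheory Set Literature.NumberTheory.Transcendental Literature.NumberTheory.Transcendental.KZ
open Summit.KontsevichZagierPeriods.FermatIsogeny.BetaLinearSector.HalfIntegers
open Summit.KontsevichZagierPeriods.KontsevichZagierPeriods.Theorems.GKZLevelThree (isAlgebraic_sqrt_three)

set_option quotPrecheck false in
/-- `r` is PINNED as `[(0,1), c · t^{a-1}(1-t)^{b-1}]` (the two hypotheses on each representation in the crux, with a constant). -/
local notation "Pinned⟦" c ", " a ", " b ", " r "⟧" =>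
  (IntegralRep.domain r = {x : Fin 1 → ℝ | x 0 ∈ Set.Ioo (0:ℝ) 1} ∧
    Set.EqOn (IntegralRep.integrand r) (fun x : Fin 1 → ℝ => (c : ℝ) * (x 0) ^ (((a : ℚ) : ℝ) - 1) * (1 - x 0) ^ (((b : ℚ) : ℝ) - 1))
      (IntegralRep.domain r))

set_option quotPrecheck false in
/-- The two-sided, constant-carrying form of the crux for fixed exponents: any two representations pinned as `[c·β(a,b)]`,
`[c'·β(a',b')]` (`c, c'` real algebraic) with equal values are KZ-equivalent. -/
local notation "P⟦" a ", " b ", " a' ", " b' "⟧" =>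
  (∀ (c c' : ℝ) (r r' : IntegralRep 1), IsAlgebraic ℚ c → IsAlgebraic ℚ c' →
    Pinned⟦c, a, b, r⟧ → Pinned⟦c', a', b', r'⟧ → IntegralRep.value r = IntegralRep.value r' → Equivalent r r')

/-! ## Part I — level reduction keeping third-integrality -/

/-- LEVEL REDUCTION on the left pair, KEEPING THIRD-INTEGRALITY: if `P⟦a₀, b₀, a', b'⟧` holds for all third-integer exponents
`a₀, b₀ ∈ (0,1]`, it holds for all positive third-integers `a, b` (strong induction on `⌊a⌋ + ⌊b⌋`, translating and swapping with
the landed chains `P_lower_left`, `P_swap_left`; `b − 1` is a third-integer when `b` is). [folklore] -/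
theorem P_of_base_left_third {a' b' : ℚ}
    (base : ∀ a b : ℚ, 0 < a → a ≤ 1 → 0 < b → b ≤ 1 → (∃ m : ℤ, a = m / 3) → (∃ m : ℤ, b = m / 3) → P⟦a, b, a', b'⟧) :
    ∀ a b : ℚ, 0 < a → 0 < b → (∃ m : ℤ, a = m / 3) → (∃ m : ℤ, b = m / 3) → P⟦a, b, a', b'⟧ := by
  have hsub : ∀ {q : ℚ}, (∃ m : ℤ, q = m / 3) → ∃ m : ℤ, q - 1 = m / 3 := by
    rintro q ⟨m, rfl⟩
    exact ⟨m - 3, by push_cast; ring⟩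
  suffices H : ∀ n : ℕ, ∀ a b : ℚ, ⌊a⌋₊ + ⌊b⌋₊ = n → 0 < a → 0 < b → (∃ m : ℤ, a = m / 3) → (∃ m : ℤ, b = m / 3) →
      P⟦a, b, a', b'⟧ from
    fun a b ha hb hma hmb => H _ a b rfl ha hb hma hmb
  intro n
  induction n using Nat.strong_induction_on with
  | _ n ih =>
    intro a b hn ha hb hma hmb
    by_cases hb1 : b ≤ 1
    · by_cases ha1 : a ≤ 1
      · exact base a b ha ha1 hb hb1 hma hmb
      · push Not at ha1
        have ha' : 0 < a - 1 := by linarith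
        have hfl : ⌊a⌋₊ = ⌊a - 1⌋₊ + 1 := by
          conv_lhs => rw [← sub_add_cancel a 1]
          exact Nat.floor_add_one ha'.le
        have hlt : ⌊b⌋₊ + ⌊a - 1⌋₊ < n := by omega
        have hP : P⟦b, (a - 1), a', b'⟧ := ih _ hlt b (a - 1) rfl hb ha' hmb (hsub hma)
        have hP' : P⟦b, a, a', b'⟧ := by simpa using P_lower_left hb ha' hP
        exact P_swap_left ha hb hP'
    · push Not at hb1
      have hb' : 0 < b - 1 := by linarith
      have hfl : ⌊b⌋₊ = ⌊b - 1⌋₊ + 1 := by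
        conv_lhs => rw [← sub_add_cancel b 1]
        exact Nat.floor_add_one hb'.le
      have hlt : ⌊a⌋₊ + ⌊b - 1⌋₊ < n := by omega
      have hP : P⟦a, (b - 1), a', b'⟧ := ih _ hlt a (b - 1) rfl ha hb' hma (hsub hmb)
      simpa using P_lower_left ha hb' hP

/-- A positive third-integer in `(0,1]` is `1/3`, `2/3` or `1`. [folklore] -/
theorem third_cases {a : ℚ} (ha : 0 < a) (ha1 : a ≤ 1) (hm : ∃ m : ℤ, a = m / 3) : a = 1 / 3 ∨ a = 2 / 3 ∨ a = 1 := by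
  obtain ⟨m, rfl⟩ := hm
  have h1 : (0 : ℚ) < m := by linarith
  have h2 : (m : ℚ) ≤ 3 := by linarith
  have h1' : 0 < m := by exact_mod_cast h1
  have h2' : m ≤ 3 := by exact_mod_cast h2
  interval_cases m <;> norm_num

/-! ## Part II — level `3`: the four classes and their separation -/

set_option quotPrecheck false in
/-- The four CLASS VALUES at level `3`: `v = (1, π, Γ(1/3)³/π, π²/Γ(1/3)³)` — the values of the canonical cells
`β(1,1)`, `(√3/2)·β(1/3,2/3)`, `(2/√3)·β(1/3,1/3)`, `(1/4)·β(2/3,2/3)` (a notation, not a definition). -/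
local notation "v" => (![1, Real.pi, Real.Gamma (1/3) ^ 3 / Real.pi, Real.pi ^ 2 / Real.Gamma (1/3) ^ 3] : Fin 4 → ℝ)

/-- The class values are positive. [folklore] -/
theorem v_pos (i : Fin 4) : 0 < v i := by
  have hπ := Real.pi_pos
  have hΓ : 0 < Real.Gamma (1/3) := Real.Gamma_pos_of_pos (by norm_num)
  fin_cases i <;> simp <;> positivity

/-- SEPARATION OF THE CLASSES, ordered pairs `i < j`: `v i` is never an algebraic multiple of `v j` — each instance is a forbidden
proportionality between two distinct monomials in `π`, `Γ(1/3)` (`stub_piGammaMonomial`, Chudnovsky).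
[cite: Chudnovsky1984, Ch. 7 §2 Cor. 2.3] -/
theorem v_sep_lt (i j : Fin 4) (hij : i < j) (k : ℝ) (hk : IsAlgebraic ℚ k) : v i ≠ k * v j := by
  have hπ := Real.pi_pos
  have hΓ : 0 < Real.Gamma (1/3) := Real.Gamma_pos_of_pos (by norm_num)
  have hπ0 : Real.pi ≠ 0 := hπ.ne'
  have hΓ0 : Real.Gamma (1/3) ≠ 0 := hΓ.ne'
  intro h
  fin_cases i <;> fin_cases j <;> simp at hij h
  · -- (0,1): `1 = k · π`
    refine stub_piGammaMonomial k hk 0 0 1 0 (by norm_num) ?_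
    simpa using h
  · -- (0,2): `1 = k · Γ³/π`, so `π = k · Γ³`
    refine stub_piGammaMonomial k hk 1 0 0 3 (by norm_num) ?_
    simp only [pow_one, pow_zero, mul_one, one_mul]
    field_simp at h
    linear_combination h
  · -- (0,3): `1 = k · π²/Γ³`, so `Γ³ = k · π²`
    refine stub_piGammaMonomial k hk 0 3 2 0 (by norm_num) ?_
    simp only [pow_zero, mul_one, one_mul]
    field_simp at h
    linear_combination h
  · -- (1,2): `π = k · Γ³/π`, so `π² = k · Γ³`
    refine stub_piGammaMonomial k hk 2 0 0 3 (by norm_num) ?_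
    simp only [pow_zero, mul_one, one_mul]
    field_simp at h
    linear_combination h
  · -- (1,3): `π = k · π²/Γ³`, so `Γ³ = k · π`
    refine stub_piGammaMonomial k hk 0 3 1 0 (by norm_num) ?_
    simp only [pow_zero, pow_one, mul_one, one_mul]
    field_simp at h
    linear_combination h
  · -- (2,3): `Γ³/π = k · π²/Γ³`, so `Γ⁶ = k · π³`
    refine stub_piGammaMonomial k hk 0 6 3 0 (by norm_num) ?_
    simp only [pow_zero, mul_one, one_mul]
    field_simp at h
    linear_combination h

/-- SEPARATION OF THE CLASSES: for `i ≠ j`, `v i` is not an algebraic multiple of `v j`. [cite: Chudnovsky1984, Ch. 7 §2 Cor. 2.3] -/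
theorem v_sep (i j : Fin 4) (hij : i ≠ j) (k : ℝ) (hk : IsAlgebraic ℚ k) : v i ≠ k * v j := by
  rcases lt_or_gt_of_ne hij with h | h
  · exact v_sep_lt i j h k hk
  · intro heq
    have hk0 : k ≠ 0 := by
      rintro rfl
      exact (v_pos i).ne' (by simpa using heq)
    refine v_sep_lt j i h k⁻¹ hk.inv ?_
    rw [heq]
    field_simp

/-! ## Part II — the values of the base cells -/

/-- `((1/3 : ℚ) : ℝ) = 1/3`. [folklore] -/
theorem cast_third : (((1 / 3 : ℚ)) : ℝ) = 1 / 3 := by norm_num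

/-- `((2/3 : ℚ) : ℝ) = 2/3`. [folklore] -/
theorem cast_twoThirds : (((2 / 3 : ℚ)) : ℝ) = 2 / 3 := by norm_num

/-- The value of `[c·β(1/3,2/3)]` is `c · 2π/√3`. [cite: AndrewsAskeyRoy1999, Thm 1.1.4] -/
theorem value_13_23 {c : ℝ} {r : IntegralRep 1} (hr : Pinned⟦c, (1/3 : ℚ), (2/3 : ℚ), r⟧) :
    r.value = c * (2 * Real.pi / Real.sqrt 3) := by
  rw [value_of_pinned hr (by norm_num) (by norm_num), cast_third, cast_twoThirds, stub_betaValuesThird.2.1]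

/-- The value of `[c·β(2/3,1/3)]` is `c · 2π/√3`. [cite: AndrewsAskeyRoy1999, Thm 1.1.4] -/
theorem value_23_13 {c : ℝ} {r : IntegralRep 1} (hr : Pinned⟦c, (2/3 : ℚ), (1/3 : ℚ), r⟧) :
    r.value = c * (2 * Real.pi / Real.sqrt 3) := by
  rw [value_of_pinned hr (by norm_num) (by norm_num), cast_third, cast_twoThirds,
    mul_comm (Real.Gamma (2 / 3)) (Real.Gamma (1 / 3)), show (2 / 3 : ℝ) + 1 / 3 = 1 / 3 + 2 / 3 by norm_num,
    stub_betaValuesThird.2.1]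

/-- The value of `[c·β(1/3,1/3)]` is `c · √3Γ(1/3)³/(2π)`. [cite: AndrewsAskeyRoy1999, Thm 1.1.4] -/
theorem value_13_13 {c : ℝ} {r : IntegralRep 1} (hr : Pinned⟦c, (1/3 : ℚ), (1/3 : ℚ), r⟧) :
    r.value = c * (Real.sqrt 3 * Real.Gamma (1/3) ^ 3 / (2 * Real.pi)) := by
  rw [value_of_pinned hr (by norm_num) (by norm_num), cast_third, stub_betaValuesThird.1]

/-- The value of `[c·β(2/3,2/3)]` is `c · 4π²/Γ(1/3)³`. [cite: AndrewsAskeyRoy1999, Thm 1.1.4] -/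
theorem value_23_23 {c : ℝ} {r : IntegralRep 1} (hr : Pinned⟦c, (2/3 : ℚ), (2/3 : ℚ), r⟧) :
    r.value = c * (4 * Real.pi ^ 2 / Real.Gamma (1/3) ^ 3) := by
  rw [value_of_pinned hr (by norm_num) (by norm_num), cast_twoThirds, stub_betaValuesThird.2.2]

/-! ## Part II — normal forms -/

/-- THE RATIONAL CLASS, cells `(a, 1)`: `[c·t^{a-1}] ∼ [pt, c/a]` (ONE Newton–Leibniz move with the algebraic primitive `t^a/a`,
`KZ.betaFirst_equivalent_unit_constMul`, transported through `c`). [cite: KontsevichZagier2001, §1.2 rule (3)] -/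
theorem equivalent_unit_of_pinned_a_one {c : ℝ} (hc : IsAlgebraic ℚ c) {a : ℚ} (ha : 0 < a) {r : IntegralRep 1}
    (hr : Pinned⟦c, a, (1 : ℚ), r⟧) (hk : IsAlgebraic ℚ (c * ((a : ℚ) : ℝ)⁻¹)) :
    Equivalent r (IntegralRep.unit.constMul (c * ((a : ℚ) : ℝ)⁻¹) hk) := by
  obtain ⟨T, hT⟩ := exists_pinned 1 isAlgebraic_one ha (by norm_num : (0:ℚ) < 1)
  have hinv : IsAlgebraic ℚ (((a : ℚ) : ℝ)⁻¹) := (isAlgebraic_rat ℚ a).inv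
  have hβ : Equivalent T (IntegralRep.unit.constMul (((a : ℚ) : ℝ)⁻¹) hinv) :=
    betaFirst_equivalent_unit_constMul a ha T hT.1 (fun x hx => by simp only [hT.2 hx, one_mul]) hinv
  have e₁ : Equivalent r (T.constMul c hc) := equivalent_constMul_of_pinned hc hr hT (mul_one c).symm
  refine e₁.trans ((hβ.constMul c hc).trans ?_)
  refine of_sub_of_mem_relations_of_eqOn rfl fun x _ => ?_
  simp only [IntegralRep.integrand_constMul, IntegralRep.unit_integrand]
  ring

/-- THE RATIONAL CLASS in normal form: a cell `(a, 1)` is a chain of moves away from `(c/a)·T₀`, `T₀ = [β(1,1)]`, and has value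
`c/a`. [cite: KontsevichZagier2001, §1.2] -/
theorem nf_a_one {c : ℝ} (hc : IsAlgebraic ℚ c) {a : ℚ} (ha : 0 < a) {r : IntegralRep 1} (hr : Pinned⟦c, a, (1 : ℚ), r⟧)
    {T₀ : IntegralRep 1} (hT₀ : Pinned⟦(1 : ℝ), (1 : ℚ), (1 : ℚ), T₀⟧) :
    ∃ (q : ℝ) (hk : IsAlgebraic ℚ (c * q)), 0 < q ∧ Equivalent r (T₀.constMul (c * q) hk) ∧ r.value = c * q * v 0 := by
  have haR : (0 : ℝ) < ((a : ℚ) : ℝ) := by exact_mod_cast ha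
  have hk : IsAlgebraic ℚ (c * ((a : ℚ) : ℝ)⁻¹) := hc.mul (isAlgebraic_rat ℚ a).inv
  have e₁ := equivalent_unit_of_pinned_a_one hc ha hr hk
  -- `T₀ ∼ [pt, 1]`
  have hk₀ : IsAlgebraic ℚ ((1 : ℝ) * (((1 : ℚ)) : ℝ)⁻¹) := isAlgebraic_one.mul (isAlgebraic_rat ℚ 1).inv
  have e₀ := equivalent_unit_of_pinned_a_one isAlgebraic_one (by norm_num : (0 : ℚ) < 1) hT₀ hk₀
  have e₂ : Equivalent (T₀.constMul (c * ((a : ℚ) : ℝ)⁻¹) hk)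
      (IntegralRep.unit.constMul (c * ((a : ℚ) : ℝ)⁻¹) hk) := by
    refine (e₀.constMul (c * ((a : ℚ) : ℝ)⁻¹) hk).trans ?_
    refine of_sub_of_mem_relations_of_eqOn rfl fun x _ => ?_
    simp only [IntegralRep.integrand_constMul, IntegralRep.unit_integrand]
    norm_num
  refine ⟨((a : ℚ) : ℝ)⁻¹, hk, inv_pos.2 haR, e₁.trans e₂.symm, ?_⟩
  rw [Equivalent.value_eq_holds e₁, IntegralRep.value_constMul, IntegralRep.value_unit]
  simp

/-- NORMAL FORM of the nine base cells: `[c·β(a,b)]`, `a, b ∈ {1/3, 2/3, 1}`, is a chain of moves away from `(c q)·T_i` for a positive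
real algebraic `q` and one of the four canonical cells `T₀ = [β(1,1)]`, `T₁ = [(√3/2)β(1/3,2/3)]`, `T₂ = [(2/√3)β(1/3,1/3)]`,
`T₃ = [(1/4)β(2/3,2/3)]`, and its value is `c q v_i`.  Rational class: `nf_a_one` (after a swap for `(1, b)`); the three
transcendental classes: rule 1b on the constants (after a swap for `(2/3, 1/3)`). [cite: KontsevichZagier2001, §1.2] -/
theorem normalForm {c : ℝ} (hc : IsAlgebraic ℚ c) {a b : ℚ} (ha : a = 1 / 3 ∨ a = 2 / 3 ∨ a = 1)
    (hb : b = 1 / 3 ∨ b = 2 / 3 ∨ b = 1) {r : IntegralRep 1} (hr : Pinned⟦c, a, b, r⟧) (T : Fin 4 → IntegralRep 1)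
    (hT0 : Pinned⟦(1 : ℝ), (1 : ℚ), (1 : ℚ), T 0⟧) (hT1 : Pinned⟦(Real.sqrt 3 / 2), (1/3 : ℚ), (2/3 : ℚ), T 1⟧)
    (hT2 : Pinned⟦(2 / Real.sqrt 3), (1/3 : ℚ), (1/3 : ℚ), T 2⟧) (hT3 : Pinned⟦(1/4 : ℝ), (2/3 : ℚ), (2/3 : ℚ), T 3⟧) :
    ∃ (i : Fin 4) (q : ℝ) (hk : IsAlgebraic ℚ (c * q)), 0 < q ∧ Equivalent r ((T i).constMul (c * q) hk) ∧
      r.value = c * q * v i := by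
  have hs : 0 < Real.sqrt 3 := Real.sqrt_pos.2 (by norm_num)
  have hs0 : Real.sqrt 3 ≠ 0 := hs.ne'
  have hsA := isAlgebraic_sqrt_three
  have hπ0 : Real.pi ≠ 0 := Real.pi_pos.ne'
  have hΓ0 : Real.Gamma (1/3) ≠ 0 := (Real.Gamma_pos_of_pos (by norm_num)).ne'
  -- the rational class through a swap: cells `(1, b)`
  have one_b : ∀ {b : ℚ}, 0 < b → Pinned⟦c, (1 : ℚ), b, r⟧ →
      ∃ (i : Fin 4) (q : ℝ) (hk : IsAlgebraic ℚ (c * q)), 0 < q ∧ Equivalent r ((T i).constMul (c * q) hk) ∧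
        r.value = c * q * v i := by
    intro b hb0 hr1
    obtain ⟨ρ, hρ⟩ := exists_pinned c hc hb0 (by norm_num : (0:ℚ) < 1)
    have e : Equivalent r ρ := pinned_swap hc (by norm_num) hb0 hr1 hρ
    obtain ⟨q, hk, hq, e', hval⟩ := nf_a_one hc hb0 hρ hT0
    exact ⟨0, q, hk, hq, e.trans e', by rw [Equivalent.value_eq_holds e, hval]⟩
  have hq₁ : IsAlgebraic ℚ (2 / Real.sqrt 3) := by
    simpa [div_eq_mul_inv] using (isAlgebraic_rat ℚ 2).mul hsA.inv
  have hq₂ : IsAlgebraic ℚ (Real.sqrt 3 / 2) := by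
    simpa [div_eq_mul_inv] using hsA.mul (isAlgebraic_rat ℚ 2).inv
  have hq₃ : IsAlgebraic ℚ (4 : ℝ) := by simpa using (isAlgebraic_rat ℚ 4 : IsAlgebraic ℚ (((4 : ℚ)) : ℝ))
  rcases hb with rfl | rfl | rfl
  · rcases ha with rfl | rfl | rfl
    · -- (1/3, 1/3): class 2, `q = √3/2`
      have hk : IsAlgebraic ℚ (c * (Real.sqrt 3 / 2)) := hc.mul hq₂
      refine ⟨2, Real.sqrt 3 / 2, hk, by positivity, equivalent_constMul_of_pinned hk hr hT2 ?_, ?_⟩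
      · field_simp
      · rw [value_13_13 hr]
        show _ = c * (Real.sqrt 3 / 2) * (Real.Gamma (1/3) ^ 3 / Real.pi)
        ring
    · -- (2/3, 1/3): class 1 after a swap, `q = 2/√3`
      obtain ⟨ρ, hρ⟩ := exists_pinned c hc (by norm_num : (0:ℚ) < 1/3) (by norm_num : (0:ℚ) < 2/3)
      have e : Equivalent r ρ := pinned_swap hc (by norm_num) (by norm_num) hr hρ
      have hk : IsAlgebraic ℚ (c * (2 / Real.sqrt 3)) := hc.mul hq₁
      refine ⟨1, 2 / Real.sqrt 3, hk, by positivity, e.trans (equivalent_constMul_of_pinned hk hρ hT1 ?_), ?_⟩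
      · field_simp
      · rw [value_23_13 hr]
        show _ = c * (2 / Real.sqrt 3) * Real.pi
        ring
    · exact one_b (by norm_num) hr
  · rcases ha with rfl | rfl | rfl
    · -- (1/3, 2/3): class 1, `q = 2/√3`
      have hk : IsAlgebraic ℚ (c * (2 / Real.sqrt 3)) := hc.mul hq₁
      refine ⟨1, 2 / Real.sqrt 3, hk, by positivity, equivalent_constMul_of_pinned hk hr hT1 ?_, ?_⟩
      · field_simp
      · rw [value_13_23 hr]
        show _ = c * (2 / Real.sqrt 3) * Real.pi
        ring
    · -- (2/3, 2/3): class 3, `q = 4`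
      have hk : IsAlgebraic ℚ (c * 4) := hc.mul hq₃
      refine ⟨3, 4, hk, by positivity, equivalent_constMul_of_pinned hk hr hT3 ?_, ?_⟩
      · ring
      · rw [value_23_23 hr]
        show _ = c * 4 * (Real.pi ^ 2 / Real.Gamma (1/3) ^ 3)
        ring
    · exact one_b (by norm_num) hr
  · rcases ha with rfl | rfl | rfl
    · exact ⟨0, nf_a_one hc (by norm_num) hr hT0⟩
    · exact ⟨0, nf_a_one hc (by norm_num) hr hT0⟩
    · exact ⟨0, nf_a_one hc (by norm_num) hr hT0⟩

/-! ## Part II — the base of the third-integer sector and the assembly -/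

/-- **The base of the third-integer sector**: `P⟦a, b, a', b'⟧` for all exponents in `{1/3, 2/3, 1}` — two cells in the same class
meet at the same multiple of the same canonical cell (normal forms + cancellation of the non-zero class value), cells in different
classes never share a value for non-zero algebraic constants (`v_sep`: Chudnovsky), and the degenerate constants `c = 0` give two zero
representations. [cite: KontsevichZagier2001, §1.2] [cite: Chudnovsky1984, Ch. 7 §2 Cor. 2.3] -/
theorem P_base_third {a b a' b' : ℚ} (ha : a = 1 / 3 ∨ a = 2 / 3 ∨ a = 1) (hb : b = 1 / 3 ∨ b = 2 / 3 ∨ b = 1)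
    (ha' : a' = 1 / 3 ∨ a' = 2 / 3 ∨ a' = 1) (hb' : b' = 1 / 3 ∨ b' = 2 / 3 ∨ b' = 1) : P⟦a, b, a', b'⟧ := by
  have hpos : ∀ {q : ℚ}, (q = 1 / 3 ∨ q = 2 / 3 ∨ q = 1) → 0 < q := by rintro q (rfl | rfl | rfl) <;> norm_num
  intro c c' r r' hc hc' hr hr' hv
  have hvr := value_of_pinned hr (hpos ha) (hpos hb)
  have hvr' := value_of_pinned hr' (hpos ha') (hpos hb')
  have hBpos : ∀ {p q : ℚ}, 0 < p → 0 < q →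
      0 < Real.Gamma (p:ℝ) * Real.Gamma (q:ℝ) / Real.Gamma ((p:ℝ) + (q:ℝ)) := fun {p q} hp hq => by
    have hpR : (0:ℝ) < p := by exact_mod_cast hp
    have hqR : (0:ℝ) < q := by exact_mod_cast hq
    exact div_pos (mul_pos (Real.Gamma_pos_of_pos hpR) (Real.Gamma_pos_of_pos hqR)) (Real.Gamma_pos_of_pos (by linarith))
  -- the degenerate constants
  by_cases hc0 : c = 0
  · have hc'0 : c' = 0 := by
      have h0 : c' * (Real.Gamma (a':ℝ) * Real.Gamma (b':ℝ) / Real.Gamma ((a':ℝ) + (b':ℝ))) = 0 := by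
        rw [← hvr', ← hv, hvr, hc0, zero_mul]
      exact (mul_eq_zero.1 h0).resolve_right (hBpos (hpos ha') (hpos hb')).ne'
    have h1 : of r ∈ relations := of_mem_relations_of_eqOn_zero r fun x hx => by
      rw [hr.2 hx]
      simp [hc0]
    have h2 : of r' ∈ relations := of_mem_relations_of_eqOn_zero r' fun x hx => by
      rw [hr'.2 hx]
      simp [hc'0]
    exact relations.sub_mem h1 h2
  have hc'0 : c' ≠ 0 := by
    intro h
    have h0 : c * (Real.Gamma (a:ℝ) * Real.Gamma (b:ℝ) / Real.Gamma ((a:ℝ) + (b:ℝ))) = 0 := by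
      rw [← hvr, hv, hvr', h, zero_mul]
    exact hc0 ((mul_eq_zero.1 h0).resolve_right (hBpos (hpos ha) (hpos hb)).ne')
  -- the four canonical cells
  have hsA := isAlgebraic_sqrt_three
  obtain ⟨T0, hT0⟩ := exists_pinned (1 : ℝ) isAlgebraic_one (by norm_num : (0:ℚ) < 1) (by norm_num : (0:ℚ) < 1)
  obtain ⟨T1, hT1⟩ := exists_pinned (Real.sqrt 3 / 2) (by simpa [div_eq_mul_inv] using hsA.mul (isAlgebraic_rat ℚ 2).inv)
    (by norm_num : (0:ℚ) < 1/3) (by norm_num : (0:ℚ) < 2/3)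
  obtain ⟨T2, hT2⟩ := exists_pinned (2 / Real.sqrt 3) (by simpa [div_eq_mul_inv] using (isAlgebraic_rat ℚ 2).mul hsA.inv)
    (by norm_num : (0:ℚ) < 1/3) (by norm_num : (0:ℚ) < 1/3)
  obtain ⟨T3, hT3⟩ := exists_pinned (1 / 4 : ℝ) (by simpa using (isAlgebraic_rat ℚ (1/4) : IsAlgebraic ℚ (((1/4 : ℚ)) : ℝ)))
    (by norm_num : (0:ℚ) < 2/3) (by norm_num : (0:ℚ) < 2/3)
  obtain ⟨i, q, hk, hq, e, hval⟩ := normalForm hc ha hb hr ![T0, T1, T2, T3] hT0 hT1 hT2 hT3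
  obtain ⟨i', q', hk', hq', e', hval'⟩ := normalForm hc' ha' hb' hr' ![T0, T1, T2, T3] hT0 hT1 hT2 hT3
  have h := hv
  rw [hval, hval'] at h
  by_cases hii : i = i'
  · -- same class: the same multiple of the same canonical cell
    subst hii
    have hcq : c * q = c' * q' := mul_right_cancel₀ (v_pos i).ne' h
    have emid : Equivalent ((![T0, T1, T2, T3] i).constMul (c * q) hk) ((![T0, T1, T2, T3] i).constMul (c' * q') hk') :=
      of_sub_of_mem_relations_of_eqOn rfl fun x _ => by simp only [IntegralRep.integrand_constMul, hcq]
    exact e.trans (emid.trans e'.symm)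
  · -- different classes: Chudnovsky
    exfalso
    have hcq0 : c * q ≠ 0 := mul_ne_zero hc0 hq.ne'
    refine v_sep i i' hii (c' * q' * (c * q)⁻¹) (hk'.mul hk.inv) ?_
    field_simp
    linear_combination h

/-- **`P⟦a, b, a', b'⟧` on the whole third-integer sector**: reduce the right pair, then the left pair, to level `3`
(`P_of_base_left_third`, keeping third-integrality) and apply `P_base_third`. [folklore] -/
theorem P_all_third {a b a' b' : ℚ} (ha : 0 < a) (hb : 0 < b) (ha' : 0 < a') (hb' : 0 < b')
    (hma : ∃ m : ℤ, a = m / 3) (hmb : ∃ m : ℤ, b = m / 3) (hma' : ∃ m : ℤ, a' = m / 3) (hmb' : ∃ m : ℤ, b' = m / 3) :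
    P⟦a, b, a', b'⟧ := by
  refine P_of_base_left_third (fun a₀ b₀ ha₀ ha₀1 hb₀ hb₀1 hma₀ hmb₀ => ?_) a b ha hb hma hmb
  refine P_symm (P_of_base_left_third (a' := a₀) (b' := b₀)
    (fun a₁ b₁ ha₁ ha₁1 hb₁ hb₁1 hma₁ hmb₁ => ?_) a' b' ha' hb' hma' hmb')
  exact P_base_third (third_cases ha₁ ha₁1 hma₁) (third_cases hb₁ hb₁1 hmb₁) (third_cases ha₀ ha₀1 hma₀)
    (third_cases hb₀ hb₀1 hmb₀)

/-- **`BetaLinearSector` ON THE THIRD-INTEGER SECTOR, UNCONDITIONALLY**: Conjecture 1 of Kontsevich–Zagier for every pair of Beta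
integrals `[∫₀¹ t^{a-1}(1-t)^{b-1}dt]`, `[∫₀¹ c·t^{a'-1}(1-t)^{b'-1}dt]` with `a, b, a', b' ∈ ⅓ℕ_{>0}`, `c` real algebraic, and equal
values — the registered anchor `betaLinearSector_thirds` of crux stmt-3897 (its statement restricted by the four third-integrality
hypotheses).  Inputs: the Beta integral, the proved translation/reflection chains, `β(a,1) ∼ [pt, 1/a]`, the closed forms of
`B(1/3,1/3)`, `B(1/3,2/3)`, `B(2/3,2/3)` (`stub_betaValuesThird`) and Chudnovsky's theorem through `stub_piGammaMonomial`.
[cite: KontsevichZagier2001, §1.2] [cite: Chudnovsky1984, Ch. 7 §2 Cor. 2.3] -/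
theorem betaLinearSector_thirds : ∀ (a b a' b' : ℚ) (c : ℝ), 0 < a → 0 < b → 0 < a' → 0 < b' → IsAlgebraic ℚ c →
    (∃ m : ℤ, a = m / 3) → (∃ m : ℤ, b = m / 3) → (∃ m : ℤ, a' = m / 3) → (∃ m : ℤ, b' = m / 3) →
    ∀ (r r' : KZ.IntegralRep 1), r.domain = {x | x 0 ∈ Set.Ioo (0:ℝ) 1} →
    Set.EqOn r.integrand (fun x => (x 0) ^ ((a:ℝ) - 1) * (1 - x 0) ^ ((b:ℝ) - 1)) r.domain →
    r'.domain = {x | x 0 ∈ Set.Ioo (0:ℝ) 1} →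
    Set.EqOn r'.integrand (fun x => c * (x 0) ^ ((a':ℝ) - 1) * (1 - x 0) ^ ((b':ℝ) - 1)) r'.domain →
    r.value = r'.value → KZ.Equivalent r r' := by
  intro a b a' b' c ha hb ha' hb' hc hma hmb hma' hmb' r r' hd hi hd' hi' hv
  refine P_all_third ha hb ha' hb' hma hmb hma' hmb' 1 c r r' isAlgebraic_one hc ⟨hd, fun x hx => ?_⟩ ⟨hd', hi'⟩ hv
  simp only [hi hx, one_mul]

end Summit.KontsevichZagierPeriods.FermatIsogeny.BetaLinearSector.Thirds

end
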